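import Literature.MathematicalPhysics.QuantumManyBody.PeriodicFeynmanKacCompact
import Literature.MathematicalPhysics.QuantumManyBody.PeriodicFeynmanKacFreeForm
import Literature.MathematicalPhysics.QuantumManyBody.GroundStateFeynmanKacEnergyLower
import Literature.MathematicalPhysics.QuantumManyBody.LiebYngvasonDyson
import Mathlib.Analysis.Calculus.MeanValue
import HarnessLib

/-!
# Periodic Feynman–Kac: the small-time form bound and `λ₀ ≤ E₀^per` (variational lower bound)

Topic `Literature/MathematicalPhysics/QuantumManyBody`; theorems only. Support file for the proof
of the named fact `Literature.MathematicalPhysics.QuantumManyBody.BoseGas.PeriodicGroundStateFeynmanKac`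
(`PeriodicHeatFlowSpectral.lean`), torus twin of Part I of `GroundStateFeynmanKacProofs.lean`.
One half of the identification of the top of the spectrum of the torus Feynman–Kac semigroup
`T_t = e^{-tH_N^per}` on `L²([0,L)^{3N})` with the variational ground-state energy
`periodicGroundStateEnergy v N L` (Chung–Zhao (1995), Thm 3.27 with Prop 3.29 (81), on the torus),
by a direct small-time expansion of the weighted path integral on `C¹` PERIODIC functions (no
killing term on the torus):

* `pairing_lower_bound_periodic` — for a bounded measurable periodic `ψ` and `t ≥ 0`,
  `‖ψ‖²_cell - ⟨ψ, T_t ψ⟩_cell ≤ sqIncrCell t ψ / 2 + (potential term)`, from the pointwise weight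
  defect `1 - w_t ≤ ∫₀ᵗ V^per(B_s) ds` (`one_sub_periodicWeight_le`);
* `lintegral_potential_term_le_periodic` — the potential term is `≤ t ∫_cell V^per ψ² + K t^{3/2}`
  (shift invariance of cell integrals of periodic functions, Lipschitz continuity of `ψ²`,
  `E‖√2 b_s‖ = O(√t)`);
* with `sqIncrCell t ψ ≤ 2t ∫_cell |∇ψ|²` (`PeriodicFeynmanKacFreeForm`):
  **`form_upper_bound_periodic`** `‖ψ‖²_cell - ⟨ψ, T_t ψ⟩_cell ≤ t (∫_cell|∇ψ|² + ∫_cell V^per ψ²) + K_ψ t^{3/2}`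
  for periodic `C¹` real `ψ`;
* **`ofReal_le_periodicEnergy_of_pairing_le`, `ofReal_le_periodicGroundStateEnergy_of_pairing_le`**
  — if the semigroup satisfies the Rayleigh bound `⟨f, T_t f⟩_cell ≤ e^{-λt} ‖f‖²_cell` on periodic
  `C¹` real functions (as it does for `λ = λ₀ = -log ‖T_1‖`), then `λ ≤ 𝓔^per[Ψ]` for every
  periodic trial state, i.e. `ENNReal.ofReal λ ≤ periodicGroundStateEnergy v N L`
  (splitting a complex trial state into real and imaginary parts).

## References

* K. L. Chung, Z. Zhao, *From Brownian Motion to Schrödinger's Equation* (1995), Thm 3.27,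
  Prop 3.29 (81). [ChungZhao1995]
* S. Fournais, *Length scales for BEC in the dilute Bose gas* (2021), (1.1)–(1.2) (the periodic
  form and its infimum). [Fournais2020]
-/

noncomputable section

namespace Literature.MathematicalPhysics.QuantumManyBody.BoseGas

open MeasureTheory ProbabilityTheory Filter Set
open scoped ENNReal NNReal Topology
open Literature.Probability.Process

variable {N : ℕ}

/-! ### Periodic `C¹` functions: bounds and Lipschitz constant -/

/-- **A continuous periodic function is bounded** (it factors through the compact closed cell).
[folklore] -/
theorem exists_bound_of_continuous_periodic {L : ℝ} (hL : 0 < L) {ψ : Config N → ℝ}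
    (hψ : Continuous ψ)
    (hper : ∀ (X : Config N) (i : Fin N) (k : Fin 3),
      ψ (X + Pi.single i (EuclideanSpace.single k L)) = ψ X) :
    ∃ M : ℝ, 0 ≤ M ∧ ∀ X, |ψ X| ≤ M := by
  obtain ⟨hKc, hKsub⟩ := isCompact_closedCellN N L
  obtain ⟨C, hC⟩ := hKc.exists_bound_of_continuousOn hψ.continuousOn
  refine ⟨max C 0, le_max_right _ _, fun X => ?_⟩
  rw [← apply_cellProj_of_periodic hper X, ← Real.norm_eq_abs]
  exact (hC _ (hKsub (cellProj_mem_cellN hL X))).trans (le_max_left _ _)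

/-- **A periodic `C¹` function is Lipschitz**: `|ψ Y - ψ Z| ≤ G ‖Y - Z‖` with `G ≥ 0` (mean value
inequality with the bound of the continuous periodic gradient). [folklore] -/
theorem exists_lipschitz_of_contDiff_periodic {L : ℝ} (hL : 0 < L) {ψ : Config N → ℝ}
    (hψ : ContDiff ℝ 1 ψ)
    (hper : ∀ (X : Config N) (i : Fin N) (k : Fin 3),
      ψ (X + Pi.single i (EuclideanSpace.single k L)) = ψ X) :
    ∃ G : ℝ, 0 ≤ G ∧ ∀ Y Z, |ψ Y - ψ Z| ≤ G * ‖Y - Z‖ := by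
  obtain ⟨hKc, hKsub⟩ := isCompact_closedCellN N L
  obtain ⟨C, hC⟩ := hKc.exists_bound_of_continuousOn
    ((hψ.continuous_fderiv one_ne_zero).continuousOn (s := {X : Config N | ∀ i k, X i k ∈ Set.Icc 0 L}))
  have hbound : ∀ X, ‖fderiv ℝ ψ X‖ ≤ max C 0 := fun X => by
    have h := hC _ (hKsub (cellProj_mem_cellN hL X))
    rw [apply_cellProj_of_periodic (g := fderiv ℝ ψ) (fderiv_periodic hper) X] at h
    exact h.trans (le_max_left _ _)
  refine ⟨max C 0, le_max_right _ _, fun Y Z => ?_⟩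
  have h := Convex.norm_image_sub_le_of_norm_fderiv_le (s := Set.univ) (C := max C 0) (f := ψ)
    (fun x _ => (hψ.differentiable one_ne_zero) x) (fun x _ => hbound x)
    convex_univ (Set.mem_univ Z) (Set.mem_univ Y)
  rwa [Real.norm_eq_abs] at h

/-- A bounded measurable function on the cell (finite measure) is in every `L^p(cell)`; here
`L²(cell)`. [folklore] -/
theorem memLp_two_cellN_of_bound (L : ℝ) {ψ : Config N → ℝ} (hψm : Measurable ψ) {M : ℝ}
    (hM : ∀ X, |ψ X| ≤ M) : MemLp ψ 2 (volume.restrict (cellN N L)) := by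
  haveI : IsFiniteMeasure (volume.restrict (cellN N L) : Measure (Config N)) :=
    ⟨by rw [Measure.restrict_apply_univ]; exact (volume_cellN_ne_top N L).lt_top⟩
  exact MemLp.of_bound hψm.aestronglyMeasurable M
    (Eventually.of_forall fun X => by rw [Real.norm_eq_abs]; exact hM X)

/-- A bounded measurable function is integrable on the cell. [folklore] -/
theorem integrable_cellN_of_bound (L : ℝ) {ψ : Config N → ℝ} (hψm : Measurable ψ) {M : ℝ}
    (hM : ∀ X, |ψ X| ≤ M) : Integrable ψ (volume.restrict (cellN N L)) := by
  haveI : IsFiniteMeasure (volume.restrict (cellN N L) : Measure (Config N)) :=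
    ⟨by rw [Measure.restrict_apply_univ]; exact (volume_cellN_ne_top N L).lt_top⟩
  exact Integrable.of_bound hψm.aestronglyMeasurable M
    (Eventually.of_forall fun X => by rw [Real.norm_eq_abs]; exact hM X)

/-! ### The weight defect -/

/-- The periodised action up to time `t` is finite for a bounded periodised potential. [folklore] -/
theorem periodicPathAction_ne_top {v : ℝ → ℝ≥0∞} {L : ℝ} {C : ℝ≥0}
    (hC : ∀ x, periodizedPotential v L x ≤ C) (t : ℝ) (X : Config N) (ω : PathSpace N) :
    periodicPathAction v L t X ω ≠ ⊤ :=
  ne_top_of_le_ne_top (ENNReal.mul_ne_top (ENNReal.mul_ne_top (ENNReal.natCast_ne_top _)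
    ENNReal.coe_ne_top) ENNReal.ofReal_ne_top) (periodicPathAction_le_of_bound (C := (C : ℝ≥0∞))
      (fun x => hC x) t X ω)

/-- **Weight defect**: `1 - w_t(X, ω) ≤ ∫₀ᵗ V^per(B_s) ds` for a bounded periodised potential
(`e^{-a} ≥ 1 - a`; no killing on the torus). [folklore] -/
theorem one_sub_periodicWeight_le {v : ℝ → ℝ≥0∞} {L : ℝ} {C : ℝ≥0}
    (hC : ∀ x, periodizedPotential v L x ≤ C) (t : ℝ) (X : Config N) (ω : PathSpace N) :
    1 - (periodicFKWeight v L t X ω).toReal ≤ (periodicPathAction v L t X ω).toReal := by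
  have hAtop := periodicPathAction_ne_top hC t X ω
  rw [periodicFKWeight, expNeg, if_neg hAtop, ENNReal.toReal_ofReal (Real.exp_pos _).le]
  have := Real.add_one_le_exp (-(periodicPathAction v L t X ω).toReal)
  linarith

/-- **Pointwise lower bound for the pairing integrand**:
`ψ(X) w ψ(Y) ≥ ψ(X)ψ(Y) - |ψ(X)||ψ(Y)| ∫₀ᵗ V^per`. [folklore] -/
theorem pairing_integrand_ge_periodic {v : ℝ → ℝ≥0∞} {L : ℝ} {C : ℝ≥0}
    (hC : ∀ x, periodizedPotential v L x ≤ C) (t : ℝ) (ψ : Config N → ℝ) (X : Config N)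
    (ω : PathSpace N) (Y : Config N) :
    ψ X * ψ Y - |ψ X| * |ψ Y| * (periodicPathAction v L t X ω).toReal ≤
      ψ X * ((periodicFKWeight v L t X ω).toReal * ψ Y) := by
  have h1 := one_sub_periodicWeight_le hC t X ω
  have hw0 : 0 ≤ (periodicFKWeight v L t X ω).toReal := ENNReal.toReal_nonneg
  have hw1 := toReal_periodicFKWeight_le_one v L t X ω
  set w := (periodicFKWeight v L t X ω).toReal
  set a := ψ X * ψ Y
  have hkey : a - w * a ≤ |a| * (periodicPathAction v L t X ω).toReal := by
    calc a - w * a = a * (1 - w) := by ring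
      _ ≤ |a| * (1 - w) := mul_le_mul_of_nonneg_right (le_abs_self a) (by linarith)
      _ ≤ _ := mul_le_mul_of_nonneg_left h1 (abs_nonneg a)
  rw [abs_mul] at hkey
  nlinarith [hkey]

/-! ### The potential term -/

/-- **`L¹(cell)`-Lipschitz continuity of `ψ²` under translation**, weighted by a bounded periodic
`V`: `∫_cell ψ(X)² V(X + h) dX ≤ ∫_cell ψ² V + C_V · G‖h‖ · 2‖ψ‖_{L¹(cell)}` for periodic `ψ`.
[folklore] -/
theorem setLIntegral_cellN_sq_mul_shift_le {L : ℝ} (hL : 0 < L) {ψ : Config N → ℝ}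
    (hψm : Measurable ψ)
    (hper : ∀ (X : Config N) (i : Fin N) (k : Fin 3),
      ψ (X + Pi.single i (EuclideanSpace.single k L)) = ψ X)
    {G : ℝ} (hG : 0 ≤ G) (hLip : ∀ Y Z, |ψ Y - ψ Z| ≤ G * ‖Y - Z‖) {V : Config N → ℝ≥0∞}
    (hV : Measurable V)
    (hVper : ∀ (X : Config N) (i : Fin N) (k : Fin 3),
      V (X + Pi.single i (EuclideanSpace.single k L)) = V X)
    {CV : ℝ≥0} (hCV : ∀ X, V X ≤ CV) (h : Config N) :
    ∫⁻ X in cellN N L, ENNReal.ofReal (ψ X ^ 2) * V (X + h) ≤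
      (∫⁻ X in cellN N L, ENNReal.ofReal (ψ X ^ 2) * V X) +
        (CV : ℝ≥0∞) * ENNReal.ofReal (G * ‖h‖) * (2 * ∫⁻ X in cellN N L, ‖ψ X‖ₑ) := by
  have hm2 : Measurable fun Y : Config N => ENNReal.ofReal (ψ Y ^ 2) * V Y :=
    (ENNReal.measurable_ofReal.comp (hψm.pow_const 2)).mul hV
  -- translate (shift invariance of the cell integral of the periodic `Y ↦ ψ(Y-h)² V(Y)`)
  have htr : ∫⁻ X in cellN N L, ENNReal.ofReal (ψ X ^ 2) * V (X + h) =
      ∫⁻ Y in cellN N L, ENNReal.ofReal (ψ (Y - h) ^ 2) * V Y := by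
    have := lintegral_cellN_comp_add hL (G := fun Y => ENNReal.ofReal (ψ (Y - h) ^ 2) * V Y)
      (fun Y i k => by simp only [add_sub_right_comm, hper, hVper]) h
    simp only [add_sub_cancel_right] at this
    exact this
  rw [htr]
  -- pointwise `ψ(Y-h)² ≤ ψ(Y)² + G‖h‖ (|ψ(Y-h)| + |ψ Y|)`
  have hpt : ∀ Y, ENNReal.ofReal (ψ (Y - h) ^ 2) ≤ ENNReal.ofReal (ψ Y ^ 2) +
      ENNReal.ofReal (G * ‖h‖) * (‖ψ (Y - h)‖ₑ + ‖ψ Y‖ₑ) := by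
    intro Y
    have hd : |ψ (Y - h) - ψ Y| ≤ G * ‖h‖ := by
      have := hLip (Y - h) Y
      rwa [sub_sub_cancel_left, norm_neg] at this
    have hsq : ψ (Y - h) ^ 2 ≤ ψ Y ^ 2 + G * ‖h‖ * (|ψ (Y - h)| + |ψ Y|) := by
      have h1 : ψ (Y - h) ^ 2 - ψ Y ^ 2 = (ψ (Y - h) - ψ Y) * (ψ (Y - h) + ψ Y) := by ring
      have h2 : |ψ (Y - h) ^ 2 - ψ Y ^ 2| ≤ G * ‖h‖ * (|ψ (Y - h)| + |ψ Y|) := by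
        rw [h1, abs_mul]
        exact mul_le_mul hd (abs_add_le _ _) (abs_nonneg _) (by positivity)
      linarith [le_abs_self (ψ (Y - h) ^ 2 - ψ Y ^ 2)]
    calc ENNReal.ofReal (ψ (Y - h) ^ 2)
        ≤ ENNReal.ofReal (ψ Y ^ 2 + G * ‖h‖ * (|ψ (Y - h)| + |ψ Y|)) := ENNReal.ofReal_le_ofReal hsq
      _ = ENNReal.ofReal (ψ Y ^ 2) + ENNReal.ofReal (G * ‖h‖) * (‖ψ (Y - h)‖ₑ + ‖ψ Y‖ₑ) := by
          rw [ENNReal.ofReal_add (sq_nonneg _) (by positivity), ENNReal.ofReal_mul (by positivity),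
            ENNReal.ofReal_add (abs_nonneg _) (abs_nonneg _), ← Real.enorm_eq_ofReal_abs,
            ← Real.enorm_eq_ofReal_abs]
  have hme : Measurable fun Y : Config N => ‖ψ Y‖ₑ := hψm.enorm
  have hmeh : Measurable fun Y : Config N => ‖ψ (Y - h)‖ₑ := (hψm.comp (measurable_sub_const h)).enorm
  calc ∫⁻ Y in cellN N L, ENNReal.ofReal (ψ (Y - h) ^ 2) * V Y
      ≤ ∫⁻ Y in cellN N L, (ENNReal.ofReal (ψ Y ^ 2) * V Y +
          (CV : ℝ≥0∞) * ENNReal.ofReal (G * ‖h‖) * (‖ψ (Y - h)‖ₑ + ‖ψ Y‖ₑ)) := by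
        refine lintegral_mono fun Y => ?_
        calc ENNReal.ofReal (ψ (Y - h) ^ 2) * V Y
            ≤ (ENNReal.ofReal (ψ Y ^ 2) + ENNReal.ofReal (G * ‖h‖) * (‖ψ (Y - h)‖ₑ + ‖ψ Y‖ₑ)) * V Y :=
              mul_le_mul' (hpt Y) le_rfl
          _ = ENNReal.ofReal (ψ Y ^ 2) * V Y + ENNReal.ofReal (G * ‖h‖) * (‖ψ (Y - h)‖ₑ + ‖ψ Y‖ₑ) * V Y := by
              rw [add_mul]
          _ ≤ ENNReal.ofReal (ψ Y ^ 2) * V Y +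
              ENNReal.ofReal (G * ‖h‖) * (‖ψ (Y - h)‖ₑ + ‖ψ Y‖ₑ) * (CV : ℝ≥0∞) := by
              gcongr
              exact hCV Y
          _ = _ := by ring
    _ = (∫⁻ Y in cellN N L, ENNReal.ofReal (ψ Y ^ 2) * V Y) +
        (CV : ℝ≥0∞) * ENNReal.ofReal (G * ‖h‖) * ∫⁻ Y in cellN N L, (‖ψ (Y - h)‖ₑ + ‖ψ Y‖ₑ) := by
        have hsum : Measurable fun Y : Config N => ‖ψ (Y - h)‖ₑ + ‖ψ Y‖ₑ := hmeh.add hme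
        rw [lintegral_add_left hm2, lintegral_const_mul _ hsum]
    _ = _ := by
        rw [lintegral_add_left hmeh]
        have htr2 : ∫⁻ Y in cellN N L, ‖ψ (Y - h)‖ₑ = ∫⁻ Y in cellN N L, ‖ψ Y‖ₑ := by
          have := lintegral_cellN_comp_add hL (G := fun Y => ‖ψ Y‖ₑ)
            (fun Y i k => by simp only [hper]) (-h)
          simpa only [← sub_eq_add_neg] using this
        rw [htr2, two_mul]

/-- Tonelli for the potential term:
`∫_cell dX E[ψ(X)² ∫₀ᵗ V^per(B_s) ds] = ∫₀ᵗ ds E ∫_cell ψ(X)² V^per(X + √2 b_s) dX`. [folklore] -/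
theorem setLIntegral_cellN_sq_mul_periodicPathAction_eq {v : ℝ → ℝ≥0∞} (hv : Measurable v) (L : ℝ)
    {ψ : Config N → ℝ} (hψm : Measurable ψ) (t : ℝ) :
    ∫⁻ X in cellN N L, ∫⁻ ω, ENNReal.ofReal (ψ X ^ 2) * periodicPathAction v L t X ω ∂wienerPaths N ∂volume =
      ∫⁻ s in Set.Ioc (0 : ℝ) t, ∫⁻ ω, ∫⁻ X in cellN N L, ENNReal.ofReal (ψ X ^ 2) *
        periodicInteraction v L (X + displacement s.toNNReal ω) ∂volume ∂wienerPaths N ∂volume := by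
  have hVm : Measurable (periodicInteraction (N := N) v L) := measurable_periodicInteraction hv L
  -- measurability of the triple integrand in its three groupings
  have hXω_s : ∀ X : Config N, Measurable fun p : PathSpace N × ℝ =>
      ENNReal.ofReal (ψ X ^ 2) * periodicInteraction v L (worldLine X p.1 p.2.toNNReal) := fun X =>
    (hVm.comp (measurable_worldLine_uncurry X)).const_mul _
  have hXs_ω : Measurable fun q : (Config N × ℝ) × PathSpace N =>
      ENNReal.ofReal (ψ q.1.1 ^ 2) * periodicInteraction v L (worldLine q.1.1 q.2 q.1.2.toNNReal) := by
    have h1 : Measurable fun q : (Config N × ℝ) × PathSpace N => worldLine q.1.1 q.2 q.1.2.toNNReal :=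
      measurable_worldLine_prod.comp (((measurable_fst.comp measurable_fst).prodMk
        measurable_snd).prodMk (measurable_snd.comp measurable_fst))
    exact (ENNReal.measurable_ofReal.comp ((hψm.comp (measurable_fst.comp measurable_fst)).pow_const
      2)).mul (hVm.comp h1)
  have hX_s : Measurable fun q : Config N × ℝ => ∫⁻ ω, ENNReal.ofReal (ψ q.1 ^ 2) *
      periodicInteraction v L (worldLine q.1 ω q.2.toNNReal) ∂wienerPaths N := hXs_ω.lintegral_prod_right'
  have hXω : ∀ s : ℝ, Measurable fun q : Config N × PathSpace N =>
      ENNReal.ofReal (ψ q.1 ^ 2) * periodicInteraction v L (worldLine q.1 q.2 s.toNNReal) := fun s =>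
    (ENNReal.measurable_ofReal.comp ((hψm.comp measurable_fst).pow_const 2)).mul
      (hVm.comp (measurable_worldLine_uncurry' _))
  -- Step 1: the action as an integral in time
  have h1 : ∀ (X : Config N) (ω : PathSpace N), ENNReal.ofReal (ψ X ^ 2) * periodicPathAction v L t X ω =
      ∫⁻ s in Set.Ioc (0 : ℝ) t, ENNReal.ofReal (ψ X ^ 2) *
        periodicInteraction v L (worldLine X ω s.toNNReal) := by
    intro X ω
    have hm : Measurable fun s : ℝ => periodicInteraction v L (worldLine X ω s.toNNReal) :=
      hVm.comp (continuous_worldLine_toNNReal X ω).measurable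
    rw [periodicPathAction, ← lintegral_const_mul _ hm]
  simp_rw [h1]
  -- Step 2: swap `ω ↔ s` for each `X`
  have h2 : ∀ X : Config N, ∫⁻ ω, ∫⁻ s in Set.Ioc (0 : ℝ) t, ENNReal.ofReal (ψ X ^ 2) *
      periodicInteraction v L (worldLine X ω s.toNNReal) ∂volume ∂wienerPaths N =
      ∫⁻ s in Set.Ioc (0 : ℝ) t, ∫⁻ ω, ENNReal.ofReal (ψ X ^ 2) *
        periodicInteraction v L (worldLine X ω s.toNNReal) ∂wienerPaths N ∂volume := fun X =>
    lintegral_lintegral_swap (hXω_s X).aemeasurable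
  simp_rw [h2]
  -- Step 3: swap `X ↔ s`
  rw [lintegral_lintegral_swap hX_s.aemeasurable]
  -- Step 4: swap `X ↔ ω` inside
  refine lintegral_congr fun s => ?_
  rw [lintegral_lintegral_swap (hXω s).aemeasurable]
  rfl

/-- **The potential term**: for periodic measurable `ψ` with Lipschitz constant `G` and a bounded
periodised potential `v^per ≤ C` (`V^per = ∑_{i<j} v^per ≤ N²C`), for `t > 0`,
`∫_cell dX E[|ψ(X)| |ψ(B_t)| ∫₀ᵗ V^per(B_s)ds] ≤ t ∫_cell ψ² V^per + t · 3 N²C G (√2·3N·2√t) · ‖ψ‖_{L¹(cell)}`.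
[folklore] -/
theorem lintegral_potential_term_le_periodic {v : ℝ → ℝ≥0∞} (hv : Measurable v) {L : ℝ}
    (hL : 0 < L) {C : ℝ≥0} (hC : ∀ x, periodizedPotential v L x ≤ C) {ψ : Config N → ℝ}
    (hψm : Measurable ψ)
    (hper : ∀ (X : Config N) (i : Fin N) (k : Fin 3),
      ψ (X + Pi.single i (EuclideanSpace.single k L)) = ψ X)
    {G : ℝ} (hG : 0 ≤ G) (hLip : ∀ Y Z, |ψ Y - ψ Z| ≤ G * ‖Y - Z‖) {t : ℝ≥0} (ht : t ≠ 0) :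
    ∫⁻ X in cellN N L, ∫⁻ ω, ‖ψ X‖ₑ * ‖ψ (X + displacement t ω)‖ₑ * periodicPathAction v L t X ω
        ∂wienerPaths N ∂volume ≤
      ENNReal.ofReal t * (∫⁻ X in cellN N L, ENNReal.ofReal (ψ X ^ 2) * periodicInteraction v L X) +
        ENNReal.ofReal (t * (3 * (((N * N : ℕ) : ℝ) * C) * G *
          (Real.sqrt 2 * ((3 * N : ℕ) * (2 * Real.sqrt t))))) * ∫⁻ X in cellN N L, ‖ψ X‖ₑ := by
  have ht' : (0 : ℝ) < t := lt_of_le_of_ne t.coe_nonneg (fun h => ht (by exact_mod_cast h.symm))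
  set CV : ℝ≥0 := (N * N : ℕ) * C with hCVdef
  set m : ℝ := Real.sqrt 2 * ((3 * N : ℕ) * (2 * Real.sqrt t)) with hm
  have hm0 : 0 ≤ m := by positivity
  have hVle : ∀ X : Config N, periodicInteraction v L X ≤ CV := fun X => by
    have := periodicInteraction_le_of_bound (C := (C : ℝ≥0∞)) (fun x => hC x) X
    simpa [hCVdef] using this
  have hVm : Measurable (periodicInteraction (N := N) v L) := measurable_periodicInteraction hv L
  have hAle : ∀ (X : Config N) (ω : PathSpace N), periodicPathAction v L t X ω ≤
      (CV : ℝ≥0∞) * ENNReal.ofReal t := by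
    intro X ω
    have := periodicPathAction_le_of_bound (C := (C : ℝ≥0∞)) (fun x => hC x) t X ω
    simpa [hCVdef, mul_assoc] using this
  have hme : Measurable fun Y : Config N => ‖ψ Y‖ₑ := hψm.enorm
  set P : ℝ≥0∞ := ∫⁻ X in cellN N L, ENNReal.ofReal (ψ X ^ 2) * periodicInteraction v L X with hP
  set I : ℝ≥0∞ := ∫⁻ X in cellN N L, ‖ψ X‖ₑ with hI
  -- pointwise: `|ψ(B_t)| ≤ |ψ X| + G ‖D_t‖`
  have hpt : ∀ (X : Config N) (ω : PathSpace N),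
      ‖ψ X‖ₑ * ‖ψ (X + displacement t ω)‖ₑ * periodicPathAction v L t X ω ≤
        ENNReal.ofReal (ψ X ^ 2) * periodicPathAction v L t X ω +
          ‖ψ X‖ₑ * ENNReal.ofReal G * ‖displacement t ω‖ₑ * ((CV : ℝ≥0∞) * ENNReal.ofReal t) := by
    intro X ω
    have h1 : ‖ψ (X + displacement t ω)‖ₑ ≤ ‖ψ X‖ₑ + ENNReal.ofReal G * ‖displacement t ω‖ₑ := by
      have := hLip (X + displacement t ω) X
      rw [add_sub_cancel_left] at this
      have h2 : |ψ (X + displacement t ω)| ≤ |ψ X| + G * ‖displacement t ω‖ := by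
        linarith [abs_sub_abs_le_abs_sub (ψ (X + displacement t ω)) (ψ X)]
      calc ‖ψ (X + displacement t ω)‖ₑ = ENNReal.ofReal |ψ (X + displacement t ω)| :=
            Real.enorm_eq_ofReal_abs _
        _ ≤ ENNReal.ofReal (|ψ X| + G * ‖displacement t ω‖) := ENNReal.ofReal_le_ofReal h2
        _ = _ := by
            rw [ENNReal.ofReal_add (abs_nonneg _) (by positivity), ENNReal.ofReal_mul hG,
              ← Real.enorm_eq_ofReal_abs, ofReal_norm]
    calc ‖ψ X‖ₑ * ‖ψ (X + displacement t ω)‖ₑ * periodicPathAction v L t X ω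
        ≤ ‖ψ X‖ₑ * (‖ψ X‖ₑ + ENNReal.ofReal G * ‖displacement t ω‖ₑ) * periodicPathAction v L t X ω := by
          gcongr
      _ = ‖ψ X‖ₑ * ‖ψ X‖ₑ * periodicPathAction v L t X ω +
          ‖ψ X‖ₑ * ENNReal.ofReal G * ‖displacement t ω‖ₑ * periodicPathAction v L t X ω := by ring
      _ ≤ _ := by
          gcongr
          · rw [Real.enorm_eq_ofReal_abs, ← ENNReal.ofReal_mul (abs_nonneg _), ← sq, sq_abs]
          · exact hAle X ω
  -- part (b): the gradient term
  have hconst : ENNReal.ofReal G * ((CV : ℝ≥0∞) * ENNReal.ofReal t) * ENNReal.ofReal m =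
      ENNReal.ofReal (t * (CV * G * m)) := by
    rw [← ENNReal.ofReal_coe_nnreal, ← ENNReal.ofReal_mul (by positivity : (0 : ℝ) ≤ CV),
      ← ENNReal.ofReal_mul hG, ← ENNReal.ofReal_mul (by positivity : (0 : ℝ) ≤ G * (CV * t))]
    congr 1
    ring
  have hb : ∫⁻ X in cellN N L, ∫⁻ ω, ‖ψ X‖ₑ * ENNReal.ofReal G * ‖displacement t ω‖ₑ *
      ((CV : ℝ≥0∞) * ENNReal.ofReal t) ∂wienerPaths N ∂volume ≤ ENNReal.ofReal (t * (CV * G * m)) * I := by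
    have hDm : Measurable fun ω : PathSpace N => ‖displacement t ω‖ₑ :=
      (measurable_displacement (N := N) t).enorm
    have h1 : ∀ X : Config N, ∫⁻ ω, ‖ψ X‖ₑ * ENNReal.ofReal G * ‖displacement t ω‖ₑ *
        ((CV : ℝ≥0∞) * ENNReal.ofReal t) ∂wienerPaths N =
        ‖ψ X‖ₑ * (ENNReal.ofReal G * ((CV : ℝ≥0∞) * ENNReal.ofReal t) *
          ∫⁻ ω, ‖displacement t ω‖ₑ ∂wienerPaths N) := by
      intro X
      rw [← lintegral_const_mul _ hDm, ← lintegral_const_mul _ (hDm.const_mul _)]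
      refine lintegral_congr fun ω => ?_
      ring
    simp_rw [h1]
    rw [lintegral_mul_const _ hme]
    calc I * (ENNReal.ofReal G * ((CV : ℝ≥0∞) * ENNReal.ofReal t) *
          ∫⁻ ω, ‖displacement t ω‖ₑ ∂wienerPaths N)
        ≤ I * (ENNReal.ofReal G * ((CV : ℝ≥0∞) * ENNReal.ofReal t) * ENNReal.ofReal m) :=
          mul_le_mul' le_rfl (mul_le_mul' le_rfl (lintegral_norm_displacement_le le_rfl))
      _ = ENNReal.ofReal (t * (CV * G * m)) * I := by rw [hconst, mul_comm]
  -- part (a): the main term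
  have ha : ∫⁻ X in cellN N L, ∫⁻ ω, ENNReal.ofReal (ψ X ^ 2) * periodicPathAction v L t X ω
      ∂wienerPaths N ∂volume ≤
      ENNReal.ofReal t * P + ENNReal.ofReal (t * (2 * (CV * G * m))) * I := by
    rw [setLIntegral_cellN_sq_mul_periodicPathAction_eq hv L hψm]
    have hDm : ∀ s : ℝ≥0, Measurable fun ω : PathSpace N => ‖displacement s ω‖ₑ := fun s =>
      (measurable_displacement (N := N) s).enorm
    -- bound the inner double integral uniformly in `s ∈ (0, t]`
    have hinner : ∀ s ∈ Set.Ioc (0 : ℝ) t, ∫⁻ ω, ∫⁻ X in cellN N L, ENNReal.ofReal (ψ X ^ 2) *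
        periodicInteraction v L (X + displacement s.toNNReal ω) ∂volume ∂wienerPaths N ≤
        P + (CV : ℝ≥0∞) * ENNReal.ofReal G * ENNReal.ofReal m * (2 * I) := by
      intro s hs
      have hs' : s.toNNReal ≤ t := Real.toNNReal_le_iff_le_coe.2 hs.2
      calc ∫⁻ ω, ∫⁻ X in cellN N L, ENNReal.ofReal (ψ X ^ 2) *
            periodicInteraction v L (X + displacement s.toNNReal ω) ∂volume ∂wienerPaths N
          ≤ ∫⁻ ω, (P + (CV : ℝ≥0∞) * ENNReal.ofReal (G * ‖displacement s.toNNReal ω‖) * (2 * I))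
              ∂wienerPaths N :=
            lintegral_mono fun ω => setLIntegral_cellN_sq_mul_shift_le hL hψm hper hG hLip hVm
              (periodicInteraction_add_single v L) hVle _
        _ = P + (CV : ℝ≥0∞) * ENNReal.ofReal G * (2 * I) *
              ∫⁻ ω, ‖displacement s.toNNReal ω‖ₑ ∂wienerPaths N := by
            rw [lintegral_add_left (f := fun _ => P) measurable_const, lintegral_const, measure_univ,
              mul_one]
            congr 1
            rw [← lintegral_const_mul _ (hDm _)]
            refine lintegral_congr fun ω => ?_
            rw [ENNReal.ofReal_mul hG, ofReal_norm]
            ring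
        _ ≤ P + (CV : ℝ≥0∞) * ENNReal.ofReal G * (2 * I) * ENNReal.ofReal m := by
            gcongr
            exact lintegral_norm_displacement_le hs'
        _ = _ := by ring
    have hconst2 : ENNReal.ofReal t * ((CV : ℝ≥0∞) * ENNReal.ofReal G * ENNReal.ofReal m * (2 * I)) =
        ENNReal.ofReal (t * (2 * (CV * G * m))) * I := by
      rw [← ENNReal.ofReal_coe_nnreal, ← ENNReal.ofReal_ofNat 2,
        ← ENNReal.ofReal_mul (by positivity : (0 : ℝ) ≤ CV),
        ← ENNReal.ofReal_mul (by positivity : (0 : ℝ) ≤ CV * G),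
        ENNReal.ofReal_mul (by positivity : (0 : ℝ) ≤ t)]
      have h2m : ENNReal.ofReal (2 * (CV * G * m)) = ENNReal.ofReal 2 * ENNReal.ofReal (CV * G * m) :=
        ENNReal.ofReal_mul zero_le_two
      rw [h2m]
      ring
    calc ∫⁻ s in Set.Ioc (0 : ℝ) t, ∫⁻ ω, ∫⁻ X in cellN N L, ENNReal.ofReal (ψ X ^ 2) *
          periodicInteraction v L (X + displacement s.toNNReal ω) ∂volume ∂wienerPaths N ∂volume
        ≤ ∫⁻ _s in Set.Ioc (0 : ℝ) t, (P + (CV : ℝ≥0∞) * ENNReal.ofReal G * ENNReal.ofReal m * (2 * I))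
            ∂volume := setLIntegral_mono measurable_const hinner
      _ = ENNReal.ofReal t * (P + (CV : ℝ≥0∞) * ENNReal.ofReal G * ENNReal.ofReal m * (2 * I)) := by
          rw [setLIntegral_const, Real.volume_Ioc, sub_zero, mul_comm]
      _ = _ := by rw [mul_add, hconst2]
  -- assemble
  have hmA : ∀ X : Config N, Measurable fun ω : PathSpace N =>
      ENNReal.ofReal (ψ X ^ 2) * periodicPathAction v L t X ω := fun X =>
    (measurable_periodicPathAction hv L t X).const_mul _
  have hmA' : Measurable fun X : Config N => ∫⁻ ω, ENNReal.ofReal (ψ X ^ 2) * periodicPathAction v L t X ω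
      ∂wienerPaths N :=
    ((ENNReal.measurable_ofReal.comp ((hψm.comp measurable_fst).pow_const 2)).mul
      (measurable_periodicPathAction_uncurry hv L t)).lintegral_prod_right'
  calc ∫⁻ X in cellN N L, ∫⁻ ω, ‖ψ X‖ₑ * ‖ψ (X + displacement t ω)‖ₑ * periodicPathAction v L t X ω
        ∂wienerPaths N ∂volume
      ≤ ∫⁻ X in cellN N L, ∫⁻ ω, (ENNReal.ofReal (ψ X ^ 2) * periodicPathAction v L t X ω +
          ‖ψ X‖ₑ * ENNReal.ofReal G * ‖displacement t ω‖ₑ * ((CV : ℝ≥0∞) * ENNReal.ofReal t))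
          ∂wienerPaths N ∂volume := lintegral_mono fun X => lintegral_mono fun ω => hpt X ω
    _ = ∫⁻ X in cellN N L, ∫⁻ ω, ENNReal.ofReal (ψ X ^ 2) * periodicPathAction v L t X ω ∂wienerPaths N ∂volume +
        ∫⁻ X in cellN N L, ∫⁻ ω, ‖ψ X‖ₑ * ENNReal.ofReal G * ‖displacement t ω‖ₑ *
          ((CV : ℝ≥0∞) * ENNReal.ofReal t) ∂wienerPaths N ∂volume := by
        rw [← lintegral_add_left hmA']
        refine lintegral_congr fun X => ?_
        rw [lintegral_add_left (hmA X)]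
    _ ≤ (ENNReal.ofReal t * P + ENNReal.ofReal (t * (2 * (CV * G * m))) * I) +
        ENNReal.ofReal (t * (CV * G * m)) * I := add_le_add ha hb
    _ = ENNReal.ofReal t * P + ENNReal.ofReal (t * (3 * (((N * N : ℕ) : ℝ) * C) * G *
          (Real.sqrt 2 * ((3 * N : ℕ) * (2 * Real.sqrt t))))) * I := by
        rw [add_assoc, ← add_mul, ← ENNReal.ofReal_add (by positivity) (by positivity)]
        congr 3
        simp only [hCVdef, hm]
        push_cast
        ring

/-! ### The pairing lower bound -/

/-- Uniform bound on the real functional of a bounded observable: `|(e^{-tH} ψ)(X)| ≤ sup |ψ|`.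
[folklore] -/
theorem abs_pfkReal_le_of_bound (v : ℝ → ℝ≥0∞) (L t : ℝ) {ψ : Config N → ℝ} {M : ℝ}
    (hM : ∀ X, |ψ X| ≤ M) (X : Config N) : |pfkReal v L t ψ X| ≤ M := by
  have h := norm_integral_le_of_norm_le_const (μ := wienerPaths N) (C := M)
    (f := fun ω => (periodicFKWeight v L t X ω).toReal * ψ (worldLine X ω t.toNNReal))
    (Eventually.of_forall fun ω => by
      rw [norm_mul, Real.norm_of_nonneg ENNReal.toReal_nonneg, Real.norm_eq_abs]
      calc (periodicFKWeight v L t X ω).toReal * |ψ (worldLine X ω t.toNNReal)| ≤ 1 * M :=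
            mul_le_mul (toReal_periodicFKWeight_le_one v L t X ω) (hM _) (abs_nonneg _) zero_le_one
        _ = M := one_mul M)
  rw [probReal_univ, mul_one, Real.norm_eq_abs] at h
  exact h

/-- **The pairing lower bound on the torus**: for a bounded measurable periodic `ψ`, a bounded
periodised potential and `t : ℝ≥0`,
`‖ψ‖²_cell - ⟨ψ, e^{-tH}ψ⟩_cell ≤ sqIncrCell t ψ / 2 + (potential term)` (no exit term). [folklore] -/
theorem pairing_lower_bound_periodic {v : ℝ → ℝ≥0∞} (hv : Measurable v) {L : ℝ} (hL : 0 < L)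
    {C : ℝ≥0} (hC : ∀ x, periodizedPotential v L x ≤ C) {ψ : Config N → ℝ} (hψm : Measurable ψ)
    (hper : ∀ (X : Config N) (i : Fin N) (k : Fin 3),
      ψ (X + Pi.single i (EuclideanSpace.single k L)) = ψ X)
    {M : ℝ} (hM : ∀ X, |ψ X| ≤ M) (t : ℝ≥0) :
    (∫ X in cellN N L, ψ X ^ 2) - ∫ X in cellN N L, ψ X * pfkReal v L t ψ X ≤
      (sqIncrCell L t ψ).toReal / 2 +
      (∫⁻ X in cellN N L, ∫⁻ ω, ‖ψ X‖ₑ * ‖ψ (X + displacement t ω)‖ₑ * periodicPathAction v L t X ω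
        ∂wienerPaths N ∂volume).toReal := by
  have ht0 : (0 : ℝ) ≤ t := t.coe_nonneg
  have hM0 : 0 ≤ M := (abs_nonneg _).trans (hM 0)
  have hint : Integrable ψ (volume.restrict (cellN N L)) := integrable_cellN_of_bound L hψm hM
  have hψ2 : MemLp ψ 2 (volume.restrict (cellN N L)) := memLp_two_cellN_of_bound L hψm hM
  set CV : ℝ≥0 := (N * N : ℕ) * C with hCVdef
  have hAle : ∀ (X : Config N) (ω : PathSpace N), periodicPathAction v L t X ω ≤
      (CV : ℝ≥0∞) * ENNReal.ofReal t := by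
    intro X ω
    have := periodicPathAction_le_of_bound (C := (C : ℝ≥0∞)) (fun x => hC x) t X ω
    simpa [hCVdef, mul_assoc] using this
  have hAtop : ∀ (X : Config N) (ω : PathSpace N), periodicPathAction v L t X ω ≠ ⊤ := fun X ω =>
    periodicPathAction_ne_top hC t X ω
  have hAreal : ∀ (X : Config N) (ω : PathSpace N), (periodicPathAction v L t X ω).toReal ≤ CV * t := by
    intro X ω
    have := ENNReal.toReal_mono (ENNReal.mul_ne_top ENNReal.coe_ne_top ENNReal.ofReal_ne_top) (hAle X ω)
    rwa [ENNReal.toReal_mul, ENNReal.coe_toReal, ENNReal.toReal_ofReal ht0] at this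
  -- the world-line at time `t` is `X + displacement t ω`
  have hwl : ∀ (X : Config N) (ω : PathSpace N), worldLine X ω ((t : ℝ)).toNNReal = X + displacement t ω := by
    intro X ω; rw [Real.toNNReal_coe]; rfl
  -- notation for the two integrands
  set a : Config N → PathSpace N → ℝ := fun X ω => ψ X * ψ (X + displacement t ω) with ha
  set b : Config N → PathSpace N → ℝ := fun X ω =>
    |ψ X| * |ψ (X + displacement t ω)| * (periodicPathAction v L t X ω).toReal with hb
  -- joint measurability
  have hcompm : Measurable fun p : Config N × PathSpace N => ψ (p.1 + displacement t p.2) :=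
    hψm.comp (measurable_fst.add ((measurable_displacement t).comp measurable_snd))
  have ham : Measurable fun p : Config N × PathSpace N => a p.1 p.2 := (hψm.comp measurable_fst).mul hcompm
  have hbm : Measurable fun p : Config N × PathSpace N => b p.1 p.2 :=
    ((hψm.comp measurable_fst).abs.mul hcompm.abs).mul
      (measurable_periodicPathAction_uncurry hv L t).ennreal_toReal
  have hwm : Measurable fun p : Config N × PathSpace N =>
      ψ p.1 * ((periodicFKWeight v L t p.1 p.2).toReal * ψ (p.1 + displacement t p.2)) :=
    (hψm.comp measurable_fst).mul ((measurable_periodicFKWeight_uncurry hv L t).ennreal_toReal.mul hcompm)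
  -- pointwise bounds
  have hab : ∀ X ω, |a X ω| ≤ M * M := fun X ω => by
    simp only [ha, abs_mul]; exact mul_le_mul (hM _) (hM _) (abs_nonneg _) hM0
  have hbb : ∀ X ω, |b X ω| ≤ |ψ X| * (M * (CV * t)) := fun X ω => by
    simp only [hb, abs_mul, abs_abs, abs_of_nonneg ENNReal.toReal_nonneg, mul_assoc]
    exact mul_le_mul_of_nonneg_left (mul_le_mul (hM _) (hAreal X ω) ENNReal.toReal_nonneg hM0)
      (abs_nonneg _)
  have hwb : ∀ X ω, |ψ X * ((periodicFKWeight v L t X ω).toReal * ψ (X + displacement t ω))| ≤ M * M := by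
    intro X ω
    rw [abs_mul, abs_mul, abs_of_nonneg ENNReal.toReal_nonneg]
    calc |ψ X| * ((periodicFKWeight v L t X ω).toReal * |ψ (X + displacement t ω)|) ≤ M * (1 * M) :=
          mul_le_mul (hM _) (mul_le_mul (toReal_periodicFKWeight_le_one _ _ _ _ _) (hM _) (abs_nonneg _)
            zero_le_one) (by positivity) hM0
      _ = M * M := by ring
  -- inner integrability (fixed `X`)
  have hia : ∀ X, Integrable (a X) (wienerPaths N) := fun X =>
    Integrable.of_bound (ham.comp measurable_prodMk_left).aestronglyMeasurable (M * M)
      (Eventually.of_forall fun ω => by rw [Real.norm_eq_abs]; exact hab X ω)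
  have hib : ∀ X, Integrable (b X) (wienerPaths N) := fun X =>
    Integrable.of_bound (hbm.comp measurable_prodMk_left).aestronglyMeasurable (|ψ X| * (M * (CV * t)))
      (Eventually.of_forall fun ω => by rw [Real.norm_eq_abs]; exact hbb X ω)
  have hiw : ∀ X, Integrable (fun ω => ψ X * ((periodicFKWeight v L t X ω).toReal * ψ (X + displacement t ω)))
      (wienerPaths N) := fun X =>
    Integrable.of_bound (hwm.comp measurable_prodMk_left).aestronglyMeasurable (M * M)
      (Eventually.of_forall fun ω => by rw [Real.norm_eq_abs]; exact hwb X ω)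
  -- Step 1: the pairing as a double integral, and the inner lower bound
  have hpair : ∀ X, ψ X * pfkReal v L t ψ X =
      ∫ ω, ψ X * ((periodicFKWeight v L t X ω).toReal * ψ (X + displacement t ω)) ∂wienerPaths N := by
    intro X
    rw [pfkReal, ← MeasureTheory.integral_const_mul]
    refine integral_congr_ae (Eventually.of_forall fun ω => ?_)
    simp only [hwl]
  have hinner : ∀ X, (∫ ω, a X ω ∂wienerPaths N) - (∫ ω, b X ω ∂wienerPaths N) ≤
      ψ X * pfkReal v L t ψ X := by
    intro X
    have hiab : Integrable (fun ω => a X ω - b X ω) (wienerPaths N) := (hia X).sub (hib X)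
    rw [hpair X, ← integral_sub (hia X) (hib X)]
    refine integral_mono hiab (hiw X) fun ω => ?_
    exact pairing_integrand_ge_periodic hC _ ψ X ω (X + displacement t ω)
  -- Step 2: outer integrability (everything is dominated by a multiple of `|ψ X|`)
  have hdom : ∀ (F : Config N → PathSpace N → ℝ) (K : ℝ), (Measurable fun p : Config N × PathSpace N =>
      F p.1 p.2) → (∀ X ω, |F X ω| ≤ |ψ X| * K) →
      Integrable (fun X => ∫ ω, F X ω ∂wienerPaths N) (volume.restrict (cellN N L)) := by
    intro F K hFm hFb
    refine Integrable.mono' (hint.norm.mul_const K)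
      (hFm.stronglyMeasurable.integral_prod_right' (ν := wienerPaths N)).aestronglyMeasurable
      (Eventually.of_forall fun X => ?_)
    have h := norm_integral_le_of_norm_le_const (μ := wienerPaths N) (C := |ψ X| * K) (f := F X)
      (Eventually.of_forall fun ω => by rw [Real.norm_eq_abs]; exact hFb X ω)
    rwa [probReal_univ, mul_one, ← Real.norm_eq_abs (ψ X)] at h
  have hIa : Integrable (fun X => ∫ ω, a X ω ∂wienerPaths N) (volume.restrict (cellN N L)) :=
    hdom a M ham fun X ω => by
      simp only [ha, abs_mul]; exact mul_le_mul_of_nonneg_left (hM _) (abs_nonneg _)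
  have hIb : Integrable (fun X => ∫ ω, b X ω ∂wienerPaths N) (volume.restrict (cellN N L)) :=
    hdom b _ hbm hbb
  have hIw : Integrable (fun X => ψ X * pfkReal v L t ψ X) (volume.restrict (cellN N L)) := by
    refine Integrable.mono' (hint.norm.mul_const M) (hψm.mul (measurable_pfkReal hv L _ hψm)).aestronglyMeasurable
      (Eventually.of_forall fun X => ?_)
    simp only [norm_mul, Real.norm_eq_abs]
    exact mul_le_mul_of_nonneg_left (abs_pfkReal_le_of_bound v L _ hM X) (abs_nonneg _)
  -- Step 3: integrate the inner bound
  have houter : (∫ X in cellN N L, ∫ ω, a X ω ∂wienerPaths N) - (∫ X in cellN N L, ∫ ω, b X ω ∂wienerPaths N) ≤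
      ∫ X in cellN N L, ψ X * pfkReal v L t ψ X := by
    rw [← integral_sub hIa hIb]
    exact integral_mono (hIa.sub hIb) hIw hinner
  -- Step 4: identify the two double integrals
  have hA : ∫ X in cellN N L, ∫ ω, a X ω ∂wienerPaths N =
      (∫ X in cellN N L, ψ X ^ 2) - (sqIncrCell L t ψ).toReal / 2 := by
    rw [← integral_cellN_mul_integral_shift_eq hL hψm hψ2 hper t]
    refine integral_congr_ae (Eventually.of_forall fun X => ?_)
    simp only [ha]
    exact MeasureTheory.integral_const_mul _ _
  have hbof : ∀ X ω, ENNReal.ofReal (b X ω) =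
      ‖ψ X‖ₑ * ‖ψ (X + displacement t ω)‖ₑ * periodicPathAction v L t X ω := by
    intro X ω
    simp only [hb]
    rw [ENNReal.ofReal_mul (by positivity), ENNReal.ofReal_mul (abs_nonneg _),
      ENNReal.ofReal_toReal (hAtop X ω), ← Real.enorm_eq_ofReal_abs, ← Real.enorm_eq_ofReal_abs]
  have hB : ∫ X in cellN N L, ∫ ω, b X ω ∂wienerPaths N =
      (∫⁻ X in cellN N L, ∫⁻ ω, ‖ψ X‖ₑ * ‖ψ (X + displacement t ω)‖ₑ * periodicPathAction v L t X ω
        ∂wienerPaths N ∂volume).toReal := by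
    have hin : ∀ X, ∫ ω, b X ω ∂wienerPaths N =
        (∫⁻ ω, ‖ψ X‖ₑ * ‖ψ (X + displacement t ω)‖ₑ * periodicPathAction v L t X ω ∂wienerPaths N).toReal := by
      intro X
      have hbX : AEStronglyMeasurable (b X) (wienerPaths N) :=
        (hbm.comp measurable_prodMk_left).aestronglyMeasurable
      have hb0 : 0 ≤ᵐ[wienerPaths N] b X := Eventually.of_forall fun ω => by
        simp only [hb, Pi.zero_apply]
        exact mul_nonneg (mul_nonneg (abs_nonneg _) (abs_nonneg _)) ENNReal.toReal_nonneg
      rw [integral_eq_lintegral_of_nonneg_ae hb0 hbX]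
      simp_rw [hbof]
    simp_rw [hin]
    have hFm : Measurable fun X : Config N => ∫⁻ ω, ‖ψ X‖ₑ * ‖ψ (X + displacement t ω)‖ₑ *
        periodicPathAction v L t X ω ∂wienerPaths N := by
      have : Measurable fun p : Config N × PathSpace N => ENNReal.ofReal (b p.1 p.2) :=
        ENNReal.measurable_ofReal.comp hbm
      simp_rw [hbof] at this
      exact this.lintegral_prod_right'
    refine integral_toReal hFm.aemeasurable (Eventually.of_forall fun X => ?_)
    calc ∫⁻ ω, ‖ψ X‖ₑ * ‖ψ (X + displacement t ω)‖ₑ * periodicPathAction v L t X ω ∂wienerPaths N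
        ≤ ∫⁻ _ω, ‖ψ X‖ₑ * ENNReal.ofReal M * ((CV : ℝ≥0∞) * ENNReal.ofReal t) ∂wienerPaths N := by
          refine lintegral_mono fun ω => ?_
          gcongr
          · rw [Real.enorm_eq_ofReal_abs]; exact ENNReal.ofReal_le_ofReal (hM _)
          · exact hAle X ω
      _ < ⊤ := by
          rw [lintegral_const, measure_univ, mul_one]
          exact ENNReal.mul_lt_top (ENNReal.mul_lt_top enorm_lt_top ENNReal.ofReal_lt_top)
            (ENNReal.mul_lt_top ENNReal.coe_lt_top ENNReal.ofReal_lt_top)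
  rw [hA, hB] at houter
  linarith

/-! ### The form bound -/

/-- **Small-time upper bound of the periodic Feynman–Kac form on periodic `C¹` functions.** For a
periodic `C¹` real `ψ` (`L > 0`) with `∫_cell|∇ψ|² < ∞` and `∫_cell V^per ψ² < ∞`, and a
measurable pair potential with bounded periodisation `v^per ≤ C`, there is `K ≥ 0` with, for all
`t > 0`, `‖ψ‖²_cell - ⟨ψ, e^{-tH} ψ⟩_cell ≤ t (∫_cell|∇ψ|² + ∫_cell V^per ψ²) + K t^{3/2}`. This is
the upper bound `lim sup t⁻¹⟨ψ - T_tψ, ψ⟩ ≤ 𝓔^per[ψ]` of Chung–Zhao's Prop 3.29 for the periodic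
trial class. [cite: ChungZhao1995, Thm 3.27 and Prop 3.29 (81)] -/
theorem form_upper_bound_periodic {v : ℝ → ℝ≥0∞} (hv : Measurable v) {L : ℝ} (hL : 0 < L)
    {C : ℝ≥0} (hC : ∀ x, periodizedPotential v L x ≤ C) {ψ : Config N → ℝ} (hψ : ContDiff ℝ 1 ψ)
    (hper : ∀ (X : Config N) (i : Fin N) (k : Fin 3),
      ψ (X + Pi.single i (EuclideanSpace.single k L)) = ψ X)
    (hkin : ∫⁻ X in cellN N L, realKinetic ψ X ≠ ⊤)
    (hpot : ∫⁻ X in cellN N L, ENNReal.ofReal (ψ X ^ 2) * periodicInteraction v L X ≠ ⊤) :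
    ∃ K : ℝ, 0 ≤ K ∧ ∀ t : ℝ≥0, t ≠ 0 →
      (∫ X in cellN N L, ψ X ^ 2) - ∫ X in cellN N L, ψ X * pfkReal v L t ψ X ≤
        t * ((∫⁻ X in cellN N L, realKinetic ψ X).toReal +
          (∫⁻ X in cellN N L, ENNReal.ofReal (ψ X ^ 2) * periodicInteraction v L X).toReal)
          + K * (t * Real.sqrt t) := by
  have hψm : Measurable ψ := hψ.continuous.measurable
  obtain ⟨G, hG, hLip⟩ := exists_lipschitz_of_contDiff_periodic hL hψ hper
  obtain ⟨M, hM0, hM⟩ := exists_bound_of_continuous_periodic hL hψ.continuous hper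
  have hint : Integrable ψ (volume.restrict (cellN N L)) := integrable_cellN_of_bound L hψm hM
  have hL1 : ∫⁻ X in cellN N L, ‖ψ X‖ₑ ≠ ⊤ := hint.2.ne
  set I1 : ℝ := (∫⁻ X in cellN N L, ‖ψ X‖ₑ).toReal with hI1
  set K2 : ℝ := 3 * (((N * N : ℕ) : ℝ) * C) * G * (Real.sqrt 2 * ((3 * N : ℕ) * 2)) * I1 with hK2
  have hK2nn : 0 ≤ K2 := by positivity
  refine ⟨K2, hK2nn, fun t ht => ?_⟩
  have ht' : (0 : ℝ) < t := lt_of_le_of_ne t.coe_nonneg (fun h => ht (by exact_mod_cast h.symm))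
  have hpair := pairing_lower_bound_periodic hv hL hC hψm hper hM t
  -- the free term
  have h1 : (sqIncrCell L t ψ).toReal / 2 ≤ t * (∫⁻ X in cellN N L, realKinetic ψ X).toReal := by
    have h := sqIncrCell_le_kinetic hL hψ hper t
    have hfin : ENNReal.ofReal (2 * t) * ∫⁻ Y in cellN N L, realKinetic ψ Y ≠ ⊤ :=
      ENNReal.mul_ne_top ENNReal.ofReal_ne_top hkin
    have := ENNReal.toReal_mono hfin h
    rw [ENNReal.toReal_mul, ENNReal.toReal_ofReal (by positivity)] at this
    linarith
  -- the potential term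
  have h2 : (∫⁻ X in cellN N L, ∫⁻ ω, ‖ψ X‖ₑ * ‖ψ (X + displacement t ω)‖ₑ * periodicPathAction v L t X ω
      ∂wienerPaths N ∂volume).toReal ≤
      t * (∫⁻ X in cellN N L, ENNReal.ofReal (ψ X ^ 2) * periodicInteraction v L X).toReal +
        K2 * (t * Real.sqrt t) := by
    have h := lintegral_potential_term_le_periodic hv hL hC hψm hper hG hLip ht
    have hfin : ENNReal.ofReal t * (∫⁻ X in cellN N L, ENNReal.ofReal (ψ X ^ 2) * periodicInteraction v L X) +
        ENNReal.ofReal (t * (3 * (((N * N : ℕ) : ℝ) * C) * G *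
          (Real.sqrt 2 * ((3 * N : ℕ) * (2 * Real.sqrt t))))) * ∫⁻ X in cellN N L, ‖ψ X‖ₑ ≠ ⊤ :=
      ENNReal.add_ne_top.2 ⟨ENNReal.mul_ne_top ENNReal.ofReal_ne_top hpot,
        ENNReal.mul_ne_top ENNReal.ofReal_ne_top hL1⟩
    have := ENNReal.toReal_mono hfin h
    rw [ENNReal.toReal_add (ENNReal.mul_ne_top ENNReal.ofReal_ne_top hpot)
      (ENNReal.mul_ne_top ENNReal.ofReal_ne_top hL1), ENNReal.toReal_mul, ENNReal.toReal_mul,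
      ENNReal.toReal_ofReal ht'.le, ENNReal.toReal_ofReal (by positivity)] at this
    have heq : t * (3 * (((N * N : ℕ) : ℝ) * C) * G * (Real.sqrt 2 * ((3 * N : ℕ) * (2 * Real.sqrt t)))) *
        I1 = K2 * (t * Real.sqrt t) := by
      simp only [hK2]; ring
    linarith
  calc (∫ X in cellN N L, ψ X ^ 2) - ∫ X in cellN N L, ψ X * pfkReal v L t ψ X ≤ _ := hpair
    _ ≤ t * (∫⁻ X in cellN N L, realKinetic ψ X).toReal +
        (t * (∫⁻ X in cellN N L, ENNReal.ofReal (ψ X ^ 2) * periodicInteraction v L X).toReal +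
          K2 * (t * Real.sqrt t)) := add_le_add h1 h2
    _ = _ := by ring

/-! ### Real and imaginary parts of a periodic trial state -/

/-- **The periodic energy of a trial state is the sum of the energies of its real and imaginary
parts**, `𝓔^per[Ψ] = 𝓔ℝ[re Ψ] + 𝓔ℝ[im Ψ]` with `𝓔ℝ[f] = ∫_cell|∇f|² + ∫_cell V^per f²`.
[cite: Fournais2020, (1.1)] -/
theorem periodicEnergy_eq_re_add_im {L : ℝ} {v : ℝ → ℝ≥0∞} (hv : Measurable v) (Ψ : PeriodicTrialState N L) :
    periodicEnergy v Ψ =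
      ((∫⁻ X in cellN N L, realKinetic (fun Y => (Ψ.ψ Y).re) X) +
        ∫⁻ X in cellN N L, ENNReal.ofReal ((Ψ.ψ X).re ^ 2) * periodicInteraction v L X) +
      ((∫⁻ X in cellN N L, realKinetic (fun Y => (Ψ.ψ Y).im) X) +
        ∫⁻ X in cellN N L, ENNReal.ofReal ((Ψ.ψ X).im ^ 2) * periodicInteraction v L X) := by
  have hd : Differentiable ℝ Ψ.ψ := Ψ.contDiff.differentiable one_ne_zero
  have hre : ContDiff ℝ 1 fun Y => (Ψ.ψ Y).re := Complex.reCLM.contDiff.comp Ψ.contDiff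
  have him : ContDiff ℝ 1 fun Y => (Ψ.ψ Y).im := Complex.imCLM.contDiff.comp Ψ.contDiff
  have hVm : Measurable (periodicInteraction (N := N) v L) := measurable_periodicInteraction hv L
  have hmr : Measurable fun Y => (Ψ.ψ Y).re := hre.continuous.measurable
  have hmi : Measurable fun Y => (Ψ.ψ Y).im := him.continuous.measurable
  have h1 : ∀ X, kineticDensity Ψ.ψ X + periodicInteraction v L X * (‖Ψ.ψ X‖₊ : ℝ≥0∞) ^ 2 =
      (realKinetic (fun Y => (Ψ.ψ Y).re) X + ENNReal.ofReal ((Ψ.ψ X).re ^ 2) * periodicInteraction v L X) +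
      (realKinetic (fun Y => (Ψ.ψ Y).im) X + ENNReal.ofReal ((Ψ.ψ X).im ^ 2) * periodicInteraction v L X) := by
    intro X
    rw [kineticDensity_eq_realKinetic_add hd, Dyson.nnnorm_sq_complex]
    ring
  unfold periodicEnergy
  simp_rw [h1]
  have hm1 : Measurable fun X => realKinetic (fun Y => (Ψ.ψ Y).re) X +
      ENNReal.ofReal ((Ψ.ψ X).re ^ 2) * periodicInteraction v L X :=
    (measurable_realKinetic hre).add ((ENNReal.measurable_ofReal.comp (hmr.pow_const 2)).mul hVm)
  rw [lintegral_add_left hm1, lintegral_add_left (measurable_realKinetic hre),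
    lintegral_add_left (measurable_realKinetic him)]

/-- The cell masses of the real and imaginary parts of a periodic trial state add up to one.
[folklore] -/
theorem setLIntegral_cellN_re_sq_add_im_sq {L : ℝ} (Ψ : PeriodicTrialState N L) :
    (∫⁻ X in cellN N L, ENNReal.ofReal ((Ψ.ψ X).re ^ 2)) +
      ∫⁻ X in cellN N L, ENNReal.ofReal ((Ψ.ψ X).im ^ 2) = 1 := by
  have hmr : Measurable fun Y => (Ψ.ψ Y).re :=
    (Complex.reCLM.contDiff.comp Ψ.contDiff).continuous.measurable
  have hm : Measurable fun X => ENNReal.ofReal ((Ψ.ψ X).re ^ 2) :=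
    ENNReal.measurable_ofReal.comp (hmr.pow_const 2)
  rw [← lintegral_add_left hm, ← Ψ.norm_eq]
  refine lintegral_congr fun X => ?_
  rw [Dyson.nnnorm_sq_complex]

/-! ### `λ ≤ 𝓔^per[Ψ]` from the Rayleigh bound of the semigroup -/

/-- The slope of `1 - e^{-λt}` at `0⁺` is `λ`. [folklore] -/
theorem tendsto_one_sub_exp_div_periodic (lam : ℝ) :
    Tendsto (fun t : ℝ => (1 - Real.exp (-(lam * t))) / t) (𝓝[>] 0) (𝓝 lam) := by
  have hd : HasDerivAt (fun t : ℝ => 1 - Real.exp (-(lam * t))) lam 0 := by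
    have hfun : (fun t : ℝ => -(lam * t)) = fun t => (-lam) * t := by funext t; ring
    have h1 : HasDerivAt (fun t : ℝ => -(lam * t)) (-lam) 0 := by
      rw [hfun]
      simpa using (hasDerivAt_id (0 : ℝ)).const_mul (-lam)
    have h2 : HasDerivAt (fun t : ℝ => Real.exp (-(lam * t))) (Real.exp (-(lam * 0)) * (-lam)) 0 :=
      h1.exp
    have h3 := h2.const_sub 1
    simp only [mul_zero, neg_zero, Real.exp_zero, one_mul, neg_neg] at h3
    exact h3
  have h := hd.tendsto_slope_zero_right
  refine h.congr' ?_
  filter_upwards [self_mem_nhdsWithin] with t ht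
  simp only [zero_add, mul_zero, neg_zero, Real.exp_zero, sub_self, sub_zero, smul_eq_mul]
  rw [div_eq_inv_mul]

/-- **`λ ≤ 𝓔^per[Ψ]` for every periodic trial state**, provided the torus Feynman–Kac semigroup
obeys the Rayleigh bound `⟨f, e^{-tH} f⟩_cell ≤ e^{-λt}‖f‖²_cell` on periodic `C¹` real functions
(true for `λ` = the top of its spectrum): the variational side of Chung–Zhao's Prop 3.29
(`λ₁ ≤ -inf 𝓔`, here with `H_N^per = -Δ + V^per ≥ 0` on the torus).
[cite: ChungZhao1995, Prop 3.29 (81)] -/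
theorem ofReal_le_periodicEnergy_of_pairing_le {L : ℝ} (hL : 0 < L) {v : ℝ → ℝ≥0∞} (hv : Measurable v)
    {C : ℝ≥0} (hC : ∀ x, periodizedPotential v L x ≤ C) {lam : ℝ}
    (htop : ∀ f : Config N → ℝ, ContDiff ℝ 1 f →
      (∀ (X : Config N) (i : Fin N) (k : Fin 3),
        f (X + Pi.single i (EuclideanSpace.single k L)) = f X) →
      ∀ t : ℝ, 0 < t →
        ∫ X in cellN N L, f X * pfkReal v L t f X ≤ Real.exp (-(lam * t)) * ∫ X in cellN N L, f X ^ 2)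
    (Ψ : PeriodicTrialState N L) : ENNReal.ofReal lam ≤ periodicEnergy v Ψ := by
  by_cases hE : periodicEnergy v Ψ = ⊤
  · rw [hE]; exact le_top
  -- the two real components
  set f : Config N → ℝ := fun Y => (Ψ.ψ Y).re with hf
  set g : Config N → ℝ := fun Y => (Ψ.ψ Y).im with hg
  have hfC : ContDiff ℝ 1 f := Complex.reCLM.contDiff.comp Ψ.contDiff
  have hgC : ContDiff ℝ 1 g := Complex.imCLM.contDiff.comp Ψ.contDiff
  have hfper : ∀ (X : Config N) (i : Fin N) (k : Fin 3),
      f (X + Pi.single i (EuclideanSpace.single k L)) = f X := fun X i k => by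
    simp only [hf, Ψ.periodic X i k]
  have hgper : ∀ (X : Config N) (i : Fin N) (k : Fin 3),
      g (X + Pi.single i (EuclideanSpace.single k L)) = g X := fun X i k => by
    simp only [hg, Ψ.periodic X i k]
  have hsplit := periodicEnergy_eq_re_add_im hv Ψ
  have hmass := setLIntegral_cellN_re_sq_add_im_sq Ψ
  -- finiteness of the pieces
  set Kf := ∫⁻ X in cellN N L, realKinetic f X with hKf
  set Pf := ∫⁻ X in cellN N L, ENNReal.ofReal (f X ^ 2) * periodicInteraction v L X with hPf
  set Kg := ∫⁻ X in cellN N L, realKinetic g X with hKg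
  set Pg := ∫⁻ X in cellN N L, ENNReal.ofReal (g X ^ 2) * periodicInteraction v L X with hPg
  have hEeq : periodicEnergy v Ψ = (Kf + Pf) + (Kg + Pg) := hsplit
  have hfin : (Kf + Pf) + (Kg + Pg) ≠ ⊤ := hEeq ▸ hE
  have hKf' : Kf ≠ ⊤ := fun h => hfin (by simp [h])
  have hPf' : Pf ≠ ⊤ := fun h => hfin (by simp [h])
  have hKg' : Kg ≠ ⊤ := fun h => hfin (by simp [h])
  have hPg' : Pg ≠ ⊤ := fun h => hfin (by simp [h])
  have hmf : (∫⁻ X in cellN N L, ENNReal.ofReal (f X ^ 2)) ≠ ⊤ := fun h => by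
    have := hmass; rw [h] at this; simp at this
  have hmg : (∫⁻ X in cellN N L, ENNReal.ofReal (g X ^ 2)) ≠ ⊤ := fun h => by
    have := hmass; rw [h] at this; simp at this
  -- the real masses
  obtain ⟨Mf, -, hMf⟩ := exists_bound_of_continuous_periodic hL hfC.continuous hfper
  obtain ⟨Mg, -, hMg⟩ := exists_bound_of_continuous_periodic hL hgC.continuous hgper
  have hfsq : Integrable (fun X => f X ^ 2) (volume.restrict (cellN N L)) :=
    (memLp_two_cellN_of_bound L hfC.continuous.measurable hMf).integrable_sq
  have hgsq : Integrable (fun X => g X ^ 2) (volume.restrict (cellN N L)) :=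
    (memLp_two_cellN_of_bound L hgC.continuous.measurable hMg).integrable_sq
  have hmass' : (∫ X in cellN N L, f X ^ 2) + ∫ X in cellN N L, g X ^ 2 = 1 := by
    rw [← toReal_lintegral_sq hfsq, ← toReal_lintegral_sq hgsq, ← ENNReal.toReal_add hmf hmg, hmass,
      ENNReal.toReal_one]
  -- the form bounds
  obtain ⟨K1, hK1, hb1⟩ := form_upper_bound_periodic hv hL hC hfC hfper hKf' hPf'
  obtain ⟨K2, hK2, hb2⟩ := form_upper_bound_periodic hv hL hC hgC hgper hKg' hPg'
  set E : ℝ := (Kf.toReal + Pf.toReal) + (Kg.toReal + Pg.toReal) with hEdef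
  have hEreal : (periodicEnergy v Ψ).toReal = E := by
    rw [hEeq, ENNReal.toReal_add (ENNReal.add_ne_top.2 ⟨hKf', hPf'⟩) (ENNReal.add_ne_top.2 ⟨hKg', hPg'⟩),
      ENNReal.toReal_add hKf' hPf', ENNReal.toReal_add hKg' hPg']
  -- the key inequality for every `t > 0`
  have hkey : ∀ t : ℝ, 0 < t → (1 - Real.exp (-(lam * t))) / t ≤ E + (K1 + K2) * Real.sqrt t := by
    intro t ht
    set s : ℝ≥0 := ⟨t, ht.le⟩ with hs
    have hst : (s : ℝ) = t := rfl
    have hs0 : s ≠ 0 := fun h => ht.ne' (by rw [← hst, h]; rfl)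
    have h1 := hb1 s hs0
    have h2 := hb2 s hs0
    have h3 := htop f hfC hfper t ht
    have h4 := htop g hgC hgper t ht
    rw [hst] at h1 h2
    have hsum : 1 - Real.exp (-(lam * t)) ≤ t * E + (K1 + K2) * (t * Real.sqrt t) := by
      have e1 : (∫ X in cellN N L, f X ^ 2) - ∫ X in cellN N L, f X * pfkReal v L t f X ≥
          (1 - Real.exp (-(lam * t))) * ∫ X in cellN N L, f X ^ 2 := by nlinarith [h3]
      have e2 : (∫ X in cellN N L, g X ^ 2) - ∫ X in cellN N L, g X * pfkReal v L t g X ≥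
          (1 - Real.exp (-(lam * t))) * ∫ X in cellN N L, g X ^ 2 := by nlinarith [h4]
      have e3 : (1 - Real.exp (-(lam * t))) * ((∫ X in cellN N L, f X ^ 2) + ∫ X in cellN N L, g X ^ 2) =
          1 - Real.exp (-(lam * t)) := by rw [hmass', mul_one]
      nlinarith [e1, e2, e3, h1, h2]
    rw [div_le_iff₀ ht]
    nlinarith [hsum, Real.sqrt_nonneg t]
  -- pass to the limit `t → 0⁺`
  have hlim1 := tendsto_one_sub_exp_div_periodic lam
  have hlim2 : Tendsto (fun t : ℝ => E + (K1 + K2) * Real.sqrt t) (𝓝[>] 0) (𝓝 E) := by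
    have hc : Continuous fun t : ℝ => E + (K1 + K2) * Real.sqrt t := by fun_prop
    have := hc.tendsto 0
    simp only [Real.sqrt_zero, mul_zero, add_zero] at this
    exact this.mono_left nhdsWithin_le_nhds
  have hle : lam ≤ E := le_of_tendsto_of_tendsto hlim1 hlim2
    (eventually_nhdsWithin_of_forall fun t ht => hkey t ht)
  calc ENNReal.ofReal lam ≤ ENNReal.ofReal E := ENNReal.ofReal_le_ofReal hle
    _ = periodicEnergy v Ψ := by rw [← hEreal, ENNReal.ofReal_toReal hE]

/-- **`ENNReal.ofReal λ ≤ periodicGroundStateEnergy v N L`** under the Rayleigh bound of the torus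
Feynman–Kac semigroup on periodic `C¹` functions: the variational periodic ground-state energy
(infimum of `𝓔^per` over the symmetric periodic `C¹` core, [Fournais2020] (1.2)) is at least the
top of the spectrum. [cite: ChungZhao1995, Prop 3.29 (81)] -/
theorem ofReal_le_periodicGroundStateEnergy_of_pairing_le {L : ℝ} (hL : 0 < L) {v : ℝ → ℝ≥0∞}
    (hv : Measurable v) {C : ℝ≥0} (hC : ∀ x, periodizedPotential v L x ≤ C) {lam : ℝ}
    (htop : ∀ f : Config N → ℝ, ContDiff ℝ 1 f →
      (∀ (X : Config N) (i : Fin N) (k : Fin 3),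
        f (X + Pi.single i (EuclideanSpace.single k L)) = f X) →
      ∀ t : ℝ, 0 < t →
        ∫ X in cellN N L, f X * pfkReal v L t f X ≤ Real.exp (-(lam * t)) * ∫ X in cellN N L, f X ^ 2) :
    ENNReal.ofReal lam ≤ periodicGroundStateEnergy v N L :=
  le_iInf fun Ψ => ofReal_le_periodicEnergy_of_pairing_le hL hv hC htop Ψ

end Literature.MathematicalPhysics.QuantumManyBody.BoseGas

end
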